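import Mathlib

/-!
# Radix class transport (lead c6, crux TwoProducts, line corner-log-linearization)

For `P = F · expand M C`, a base point `s` of a residue class mod `M`, the coset identity
`coeff (s + M • p) P = coeff p (ψ · C)` and the domination `s ≤ e` of the class support points `e` of `P`,
an `L`-pinned support point `e` of `P` in the class of `s` (every other support point of `P` that is
`w`-lighter than or as light as `e` lies in `L`) is transported to `e = s + M • p` with `p` a support point
of `ψ · C` all of whose lighter-or-equal competitors `q'` satisfy `s + M • q' ∈ L`.
-/

set_option linter.dupNamespace false

namespace Summit.ValiantsHypothesis.ValiantsHypothesis.Theorems.TwoProducts.RadixClassTransport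

open MvPolynomial

/-- Weights of coset points: `wt (s + M • x) = wt s + M · wt x`. -/
theorem wt_add_smul (w : Fin 2 → ℤ) (M : ℕ) (s x : Fin 2 →₀ ℕ) :
    (w 0 * ((s + M • x : Fin 2 →₀ ℕ) 0 : ℤ) + w 1 * ((s + M • x : Fin 2 →₀ ℕ) 1 : ℤ)) =
      (w 0 * (s 0 : ℤ) + w 1 * (s 1 : ℤ)) + (M : ℤ) * (w 0 * (x 0 : ℤ) + w 1 * (x 1 : ℤ)) := by
  simp only [Finsupp.add_apply, Finsupp.smul_apply, smul_eq_mul, Nat.cast_add, Nat.cast_mul]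
  ring

/-- Cancelling `M ≥ 1` in `M • x = M • y`. -/
theorem smul_cancel_of_one_le {M : ℕ} (hM : 1 ≤ M) {x y : Fin 2 →₀ ℕ} (h : M • x = M • y) :
    x = y := by
  ext i
  have hi := congrArg (fun f : (Fin 2 →₀ ℕ) => f i) h
  simp only [Finsupp.smul_apply, smul_eq_mul] at hi
  exact Nat.eq_of_mul_eq_mul_left (by omega) hi

/-- A class point above the base point is a coset point: if `e i % M = s i % M` (`i = 0, 1`) and `s ≤ e`
then `e = s + M • p` with `p = (e - s) / M` coordinatewise. -/
theorem eq_add_smul_of_mod_eq {M : ℕ} {s e : Fin 2 →₀ ℕ} (h0 : e 0 % M = s 0 % M)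
    (h1 : e 1 % M = s 1 % M) (hle : s ≤ e) :
    e = s + M • (Finsupp.mapRange (· / M) (Nat.zero_div M) (e - s) : Fin 2 →₀ ℕ) := by
  have key : ∀ i : Fin 2, e i % M = s i % M → e i = s i + M * ((e i - s i) / M) := by
    intro i hi
    have hsi : s i ≤ e i := Finsupp.le_def.1 hle i
    have hdvd : M ∣ e i - s i := Nat.dvd_of_mod_eq_zero (Nat.sub_mod_eq_zero_of_mod_eq hi)
    rw [Nat.mul_div_cancel' hdvd]
    omega
  ext i
  simp only [Finsupp.add_apply, Finsupp.smul_apply, smul_eq_mul, Finsupp.mapRange_apply,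
    Finsupp.tsub_apply]
  fin_cases i
  · exact key 0 h0
  · exact key 1 h1

/-- STUB `stub_radixClassTransport` (line corner-log-linearization, PINNED RIGID RADIX rung).
For `P = F · expand M C`, a base point `s` of a residue class mod `M`, the coset identity
`coeff (s + M • p) P = coeff p (ψ · C)` and the domination of `s` by the class support points of `P`:
an `L`-pinned support point `e` of `P` in the class of `s` is `s + M • p` with `p ∈ supp (ψ · C)`, and every
competitor `q' ∈ supp (ψ · C)`, `q' ≠ p`, of weight at most that of `p` has `s + M • q' ∈ L`. -/
theorem stub_radixClassTransport : ∀ (M : ℕ) (F ψ C : MvPolynomial (Fin 2) ℂ) (s : Fin 2 →₀ ℕ)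
    (L : Finset (Fin 2 →₀ ℕ)), 1 ≤ M →
    (∀ p : Fin 2 →₀ ℕ, MvPolynomial.coeff (s + M • p) (F * MvPolynomial.expand M C) = MvPolynomial.coeff p (ψ * C)) →
    (∀ e ∈ (F * MvPolynomial.expand M C).support, e 0 % M = s 0 % M → e 1 % M = s 1 % M → s ≤ e) →
    ∀ (w : Fin 2 → ℤ), 0 < w 0 → 0 < w 1 → ∀ e ∈ (F * MvPolynomial.expand M C).support,
    e 0 % M = s 0 % M → e 1 % M = s 1 % M →
    (∀ q ∈ (F * MvPolynomial.expand M C).support, q ≠ e →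
      w 0 * (q 0 : ℤ) + w 1 * (q 1 : ℤ) ≤ w 0 * (e 0 : ℤ) + w 1 * (e 1 : ℤ) → q ∈ L) →
    ∃ p : Fin 2 →₀ ℕ, e = s + M • p ∧ p ∈ (ψ * C).support ∧
      ∀ q' ∈ (ψ * C).support, q' ≠ p →
        w 0 * (q' 0 : ℤ) + w 1 * (q' 1 : ℤ) ≤ w 0 * (p 0 : ℤ) + w 1 * (p 1 : ℤ) → s + M • q' ∈ L := by
  intro M F ψ C s L hM hcoset hdom w _ _ e he hmod0 hmod1 hpin
  obtain ⟨p, rfl⟩ : ∃ p : Fin 2 →₀ ℕ, e = s + M • p :=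
    ⟨_, eq_add_smul_of_mod_eq hmod0 hmod1 (hdom e he hmod0 hmod1)⟩
  refine ⟨p, rfl, ?_, ?_⟩
  · rw [mem_support_iff, ← hcoset]
    exact mem_support_iff.1 he
  · intro q' hq' hne hle
    have hq : s + M • q' ∈ (F * expand M C).support := by
      rw [mem_support_iff, hcoset]
      exact mem_support_iff.1 hq'
    have hqe : s + M • q' ≠ s + M • p := fun h => hne (smul_cancel_of_one_le hM (add_left_cancel h))
    have h := hpin _ hq hqe
    rw [wt_add_smul, wt_add_smul] at h
    exact h (add_le_add le_rfl (mul_le_mul_of_nonneg_left hle (Nat.cast_nonneg M)))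

end Summit.ValiantsHypothesis.ValiantsHypothesis.Theorems.TwoProducts.RadixClassTransport
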